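import Mathlib
import Literature.NumberTheory.Transcendental.KZCalculusProofs
import Literature.NumberTheory.Transcendental.KZLogCalculusProofs
import Literature.NumberTheory.Transcendental.KZSemiCanonicalReductionProofs
import Literature.NumberTheory.Transcendental.KZDominatedFamilyRelations
import Literature.NumberTheory.Transcendental.KZIntervalPeriodProofs
import Literature.NumberTheory.Transcendental.KZIdealTetrahedron
import Summits.KontsevichZagierPeriods.KontsevichZagierPeriods.Theorems.HurwitzMicroSectorsNormalFormPrincipleLevelOneMergeBoxSubTriangle

/-!
# Stub `stub_zetaBoxTriangle` — crux `OffTetraSectorKernel`, line `odd-hyperbolic-ladder` (skeleton v8)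

`ζ(2)` INSIDE THE CALCULUS, first link: Kontsevich–Zagier's box `Z = [(0,1)², 1/(1 − xy)]`
(value `π²/6`) is move-equivalent to the `Li₂(1)`-triangle `L = [{0 < v < u < 1}, 1/(u(1 − v))]`.

Proof (one substitution, plus null-set bookkeeping, following the merge gadget
`HurwitzMicroSectors.NormalFormPrinciple.PiBox.LevelOne.merge_box_sub_triangle`, whose coordinate
lemmas `merge_snoc_init_apply_zero/one` are reused):
* (rule 1) `Z` agrees on the open box with the representation `r = [B₀, 1/(1 − x₀x₁)]` on the
  band-box `B₀ = {0 < x₀ < 1, 0 ≤ x₁ ≤ 1}`, and `B₀ ∖ (0,1)²` consists of the two null edges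
  `x₁ ∈ {0, 1}` (`KZ.of_sub_of_mem_relations_of_null`);
* (rule 2) the substitution `z₁ = x₀x₁` along the last coordinate over the open base `(0,1)`
  (`KZ.of_sub_of_mem_relations_of_affine` with `α = 0`, `β = x₀`, Jacobian `x₀`) carries `B₀`
  onto the closed-fibred triangle `T = {0 < z₀ < 1, 0 ≤ z₁ ≤ z₀}` carrying the representation
  `R = [T, 1/(z₀(1 − z₁))]`, and `1/(z₀(1 − z₀x₁)) · z₀ = 1/(1 − z₀x₁)`;
* (rule 1) `T` exceeds the open triangle `{0 < z₁ < z₀ < 1}` by the null lines `z₁ = 0`,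
  `z₁ = z₀` (`KZ.volume_setOf_last_eq_zero`, `KZ.volume_graph_eq_zero`), and the integrands
  agree on the open triangle (`KZ.of_sub_of_mem_relations_of_null`).
The auxiliary representations `r`, `R` exist: their integrands are quotients of polynomials with
non-vanishing denominators (`isSemialgebraicFunOn_aeval_div_aeval`) and are integrable because
the given `Z`, `L` are (the domains differ by null sets).

References: M. Kontsevich, D. Zagier, *Periods* (2001), §1.2 rules (1), (2). No definitions are
introduced.
-/

noncomputable section

open Set MeasureTheory
open Literature.NumberTheory.Transcendental
open Literature.ModelTheory.ExponentialFields (IsSemialgebraic)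

namespace Summit.KontsevichZagierPeriods.HyperbolicBloch.OffTetraSectorKernel

open Summit.KontsevichZagierPeriods.HurwitzMicroSectors.NormalFormPrinciple.PiBox.LevelOne
  (merge_snoc_init_apply_zero merge_snoc_init_apply_one)

/-- The Jacobian identity of the substitution `(x, y) ↦ (x, xy)` for the `ζ(2)` box:
`1/(1 − x y) = 1/(x (1 − x y)) · x` (`x ≠ 0`, `1 − x y ≠ 0`). [folklore] -/
theorem zetaBoxTriangle_identity {x y : ℝ} (hx : x ≠ 0) (hxy : 1 - x * y ≠ 0) :
    1 / (1 - x * y) = 1 / (x * (1 - x * y)) * x := by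
  field_simp

/-- The Jacobian identity at a point `z` of the band-box, the substituted point being
`(z₀, z₀ z₁) = Fin.snoc (Fin.init z) (0 + z₀ z₁)` (the shape produced by
`KZ.of_sub_of_mem_relations_of_affine` with `α = 0`, `β = z₀`; coordinates of the substituted
point by `merge_snoc_init_apply_zero/one` of the level-one merge gadget). [folklore] -/
theorem zetaBoxTriangle_identity_snoc (z : Fin 2 → ℝ) (h0 : z 0 ≠ 0) (h01 : 1 - z 0 * z 1 ≠ 0) :
    1 / (1 - z 0 * z 1) =
      1 / ((Fin.snoc (Fin.init z) (0 + Fin.init z 0 * z (Fin.last 1)) : Fin 2 → ℝ) 0 *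
          (1 - (Fin.snoc (Fin.init z) (0 + Fin.init z 0 * z (Fin.last 1)) : Fin 2 → ℝ) 1)) *
        Fin.init z 0 := by
  have hi : Fin.init z 0 = z 0 := rfl
  have hl : z (Fin.last 1) = z 1 := rfl
  rw [merge_snoc_init_apply_zero z, merge_snoc_init_apply_one z, hi, hl, zero_add]
  exact zetaBoxTriangle_identity h0 h01

/-- **STUB `stub_zetaBoxTriangle`**: Kontsevich–Zagier's `ζ(2)` box `[(0,1)², 1/(1−xy)]` is
move-equivalent to the `Li₂(1)`-triangle `[{0<v<u<1}, 1/(u(1−v))]`: ONE change of variables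
`(x, y) ↦ (x, xy)` of the open box onto the triangle (Jacobian `x`; rule (2)), the open box and the
open triangle being first replaced by the closed-fibred band-box `{0 < x < 1, 0 ≤ y ≤ 1}` and band
`{0 < u < 1, 0 ≤ v ≤ u}` (null edges; rule (1)). [cite: KontsevichZagier2001, §1.2 rule (2)] -/
theorem stub_zetaBoxTriangle :
    ∀ (Z L : KZ.IntegralRep 2), Z.domain = {x | ∀ i, x i ∈ Set.Ioo (0:ℝ) 1} →
      Set.EqOn Z.integrand (fun x => 1 / (1 - x 0 * x 1)) Z.domain →
      L.domain = {w | 0 < w 1 ∧ w 1 < w 0 ∧ w 0 < 1} →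
      Set.EqOn L.integrand (fun w => 1 / (w 0 * (1 - w 1))) L.domain →
      KZ.of Z - KZ.of L ∈ KZ.relations := by
  intro Z L hZd hZi hLd hLi
  -- the open base `G = (0,1) ⊆ ℝ¹`, the band-box `B₀` and the closed-fibred triangle `T` over it
  have hG : IsSemialgebraic ℚ {y : Fin 1 → ℝ | 0 < y 0 ∧ y 0 < 1} :=
    isSemialgebraic_unitInterval_fin_one
  have hGo : IsOpen {y : Fin 1 → ℝ | 0 < y 0 ∧ y 0 < 1} :=
    isOpen_Ioo.preimage (continuous_apply 0)
  have hB : IsSemialgebraic ℚ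
      (KZlog.band {y : Fin 1 → ℝ | 0 < y 0 ∧ y 0 < 1} (fun _ => (0:ℝ)) (fun _ => (1:ℝ))) :=
    KZlog.isSemialgebraic_band (by simpa using isSemialgebraicFunOn_ratCast hG 0)
      (by simpa using isSemialgebraicFunOn_ratCast hG 1)
  have hT : IsSemialgebraic ℚ
      (KZlog.band {y : Fin 1 → ℝ | 0 < y 0 ∧ y 0 < 1} (fun _ => (0:ℝ)) (fun y => y 0)) :=
    KZlog.isSemialgebraic_band (by simpa using isSemialgebraicFunOn_ratCast hG 0)
      (isSemialgebraicFunOn_apply hG 0)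
  -- the explicit integrands are semialgebraic on `B₀`, `T` (their denominators do not vanish)
  have hsaB : IsSemialgebraicFunOn ℚ
      (KZlog.band {y : Fin 1 → ℝ | 0 < y 0 ∧ y 0 < 1} (fun _ => (0:ℝ)) (fun _ => (1:ℝ)))
      (fun x => 1 / (1 - x 0 * x 1)) := by
    refine (isSemialgebraicFunOn_aeval_div_aeval hB 1
      (1 - MvPolynomial.X 0 * MvPolynomial.X 1) fun x hx => ?_).congr fun x _ => by simp
    have h : (0 < x 0 ∧ x 0 < 1) ∧ 0 ≤ x 1 ∧ x 1 ≤ 1 := hx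
    simp only [map_sub, map_mul, map_one, MvPolynomial.aeval_X]
    have h01 : x 0 * x 1 ≤ x 0 * 1 := mul_le_mul_of_nonneg_left h.2.2 h.1.1.le
    exact (show (0:ℝ) < 1 - x 0 * x 1 by linarith [h.1.2]).ne'
  have hsaT : IsSemialgebraicFunOn ℚ
      (KZlog.band {y : Fin 1 → ℝ | 0 < y 0 ∧ y 0 < 1} (fun _ => (0:ℝ)) (fun y => y 0))
      (fun w => 1 / (w 0 * (1 - w 1))) := by
    refine (isSemialgebraicFunOn_aeval_div_aeval hT 1
      (MvPolynomial.X 0 * (1 - MvPolynomial.X 1)) fun x hx => ?_).congr fun x _ => by simp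
    have h : (0 < x 0 ∧ x 0 < 1) ∧ 0 ≤ x 1 ∧ x 1 ≤ x 0 := hx
    simp only [map_sub, map_mul, map_one, MvPolynomial.aeval_X]
    exact mul_ne_zero h.1.1.ne' (show (0:ℝ) < 1 - x 1 by linarith [h.1.2, h.2.2]).ne'
  -- ... and integrable there: `B₀ ⊆ (0,1)² ∪ two null edges`, `T ⊆ {0<v<u<1} ∪ two null lines`
  have hZint : IntegrableOn (fun x : Fin 2 → ℝ => 1 / (1 - x 0 * x 1)) Z.domain :=
    Z.integrableOn.congr_fun hZi (KZ.IntegralRep.measurableSet_domain_holds Z)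
  have hsubB : KZlog.band {y : Fin 1 → ℝ | 0 < y 0 ∧ y 0 < 1} (fun _ => (0:ℝ)) (fun _ => (1:ℝ)) ⊆
      Z.domain ∪ ({z | z 1 = 0} ∪ {z | z 1 = 1}) := by
    intro z hz
    have h : (0 < z 0 ∧ z 0 < 1) ∧ 0 ≤ z 1 ∧ z 1 ≤ 1 := hz
    rcases h.2.1.eq_or_lt with h0 | h0
    · exact Or.inr (Or.inl h0.symm)
    rcases h.2.2.lt_or_eq with h1 | h1
    · refine Or.inl ?_
      rw [hZd]
      exact Fin.forall_fin_two.2 ⟨⟨h.1.1, h.1.2⟩, ⟨h0, h1⟩⟩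
    · exact Or.inr (Or.inr h1)
  have hintB : IntegrableOn (fun x : Fin 2 → ℝ => 1 / (1 - x 0 * x 1))
      (KZlog.band {y : Fin 1 → ℝ | 0 < y 0 ∧ y 0 < 1} (fun _ => (0:ℝ)) (fun _ => (1:ℝ))) :=
    (hZint.union ((IntegrableOn.of_measure_zero
      (Measure.pi_hyperplane (fun _ => (volume : Measure ℝ)) 1 0)).union
      (IntegrableOn.of_measure_zero
        (Measure.pi_hyperplane (fun _ => (volume : Measure ℝ)) 1 1)))).mono_set hsubB
  have hLint : IntegrableOn (fun w : Fin 2 → ℝ => 1 / (w 0 * (1 - w 1))) L.domain :=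
    L.integrableOn.congr_fun hLi (KZ.IntegralRep.measurableSet_domain_holds L)
  have hN0 : volume {z : Fin 2 → ℝ | z (Fin.last 1) = 0} = 0 := KZ.volume_setOf_last_eq_zero 0
  have hN1 : volume {z : Fin 2 → ℝ | Fin.init z ∈ {y : Fin 1 → ℝ | 0 < y 0 ∧ y 0 < 1} ∧
      z (Fin.last 1) = Fin.init z 0} = 0 :=
    KZ.volume_graph_eq_zero (isSemialgebraicFunOn_apply hG 0)
  have hsubT : KZlog.band {y : Fin 1 → ℝ | 0 < y 0 ∧ y 0 < 1} (fun _ => (0:ℝ)) (fun y => y 0) ⊆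
      L.domain ∪ ({z : Fin 2 → ℝ | z (Fin.last 1) = 0} ∪
        {z : Fin 2 → ℝ | Fin.init z ∈ {y : Fin 1 → ℝ | 0 < y 0 ∧ y 0 < 1} ∧
          z (Fin.last 1) = Fin.init z 0}) := by
    intro z hz
    have h : (0 < z 0 ∧ z 0 < 1) ∧ 0 ≤ z 1 ∧ z 1 ≤ z 0 := hz
    rcases h.2.1.eq_or_lt with h0 | h0
    · exact Or.inr (Or.inl h0.symm)
    rcases h.2.2.lt_or_eq with h1 | h1
    · refine Or.inl ?_
      rw [hLd]
      exact ⟨h0, h1, h.1.2⟩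
    · exact Or.inr (Or.inr ⟨h.1, h1⟩)
  have hintT : IntegrableOn (fun w : Fin 2 → ℝ => 1 / (w 0 * (1 - w 1)))
      (KZlog.band {y : Fin 1 → ℝ | 0 < y 0 ∧ y 0 < 1} (fun _ => (0:ℝ)) (fun y => y 0)) :=
    (hLint.union ((IntegrableOn.of_measure_zero hN0).union
      (IntegrableOn.of_measure_zero hN1))).mono_set hsubT
  -- the representations `r = [B₀, 1/(1 − x₀x₁)]` and `R = [T, 1/(z₀(1 − z₁))]`
  obtain ⟨r, hrd, hri⟩ : ∃ r : KZ.IntegralRep 2,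
      r.domain = KZlog.band {y : Fin 1 → ℝ | 0 < y 0 ∧ y 0 < 1} (fun _ => (0:ℝ)) (fun _ => (1:ℝ)) ∧
      r.integrand = fun x => 1 / (1 - x 0 * x 1) :=
    ⟨⟨_, _, hB, hsaB, hintB⟩, rfl, rfl⟩
  obtain ⟨R, hRd, hRi⟩ : ∃ R : KZ.IntegralRep 2,
      R.domain = KZlog.band {y : Fin 1 → ℝ | 0 < y 0 ∧ y 0 < 1} (fun _ => (0:ℝ)) (fun y => y 0) ∧
      R.integrand = fun w => 1 / (w 0 * (1 - w 1)) :=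
    ⟨⟨_, _, hT, hsaT, hintT⟩, rfl, rfl⟩
  -- (rule 1) `Z` versus `r`: the domains differ by two null edges, the integrands agree
  have e1 : KZ.of Z - KZ.of r ∈ KZ.relations := by
    refine KZ.of_sub_of_mem_relations_of_null Z r ?_ ?_ ?_
    · have h0 : Z.domain \ r.domain = ∅ := by
        refine eq_empty_of_forall_notMem fun z hz => hz.2 ?_
        have hz1 := hz.1
        rw [hZd] at hz1
        have h0 := hz1 0
        have h1 := hz1 1
        rw [hrd]
        show (0 < z 0 ∧ z 0 < 1) ∧ 0 ≤ z 1 ∧ z 1 ≤ 1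
        exact ⟨⟨h0.1, h0.2⟩, h1.1.le, h1.2.le⟩
      rw [h0, measure_empty]
    · refine measure_mono_null (fun z hz => ?_)
        (measure_union_null (Measure.pi_hyperplane (fun _ => (volume : Measure ℝ)) 1 0)
          (Measure.pi_hyperplane (fun _ => (volume : Measure ℝ)) 1 1))
      rcases hsubB (hrd ▸ hz.1) with h | h
      · exact absurd h hz.2
      · exact h
    · intro z hz
      rw [hZi hz.1, hri]
  -- (rule 2) `r` versus `R`: the substitution `z₁ = x₀ x₁` along the last coordinate
  have key : ∀ z ∈ r.domain, r.integrand z =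
      R.integrand (Fin.snoc (Fin.init z) (0 + Fin.init z 0 * z (Fin.last 1))) * Fin.init z 0 := by
    intro z hz
    rw [hrd] at hz
    have h : (0 < z 0 ∧ z 0 < 1) ∧ 0 ≤ z 1 ∧ z 1 ≤ 1 := hz
    have h01 : z 0 * z 1 ≤ z 0 * 1 := mul_le_mul_of_nonneg_left h.2.2 h.1.1.le
    rw [hri, hRi]
    exact zetaBoxTriangle_identity_snoc z h.1.1.ne'
      (show (0:ℝ) < 1 - z 0 * z 1 by linarith [h.1.2]).ne'
  have e2 : KZ.of r - KZ.of R ∈ KZ.relations :=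
    KZ.of_sub_of_mem_relations_of_affine (m := 1) hGo (α := fun _ => (0:ℝ)) (β := fun y => y 0)
      (a := fun _ => (0:ℝ)) (b := fun _ => (1:ℝ)) (a' := fun _ => (0:ℝ)) (b' := fun y => y 0)
      (by simpa using isSemialgebraicFunOn_ratCast hG 0) (isSemialgebraicFunOn_apply hG 0)
      (differentiableOn_const 0) (differentiableOn_apply 0 _) (fun y hy => hy.1) r R hrd hRd
      (fun y _ => by ring) (fun y _ => by ring) key
  -- (rule 1) `R` versus `L`: the domains differ by two null lines, the integrands agree
  have e3 : KZ.of R - KZ.of L ∈ KZ.relations := by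
    refine KZ.of_sub_of_mem_relations_of_null R L ?_ ?_ ?_
    · refine measure_mono_null (fun z hz => ?_) (measure_union_null hN0 hN1)
      rcases hsubT (hRd ▸ hz.1) with h | h
      · exact absurd h hz.2
      · exact h
    · have h0 : L.domain \ R.domain = ∅ := by
        refine eq_empty_of_forall_notMem fun z hz => hz.2 ?_
        have hz1 := hz.1
        rw [hLd] at hz1
        obtain ⟨h1, h10, h0⟩ := hz1
        rw [hRd]
        show (0 < z 0 ∧ z 0 < 1) ∧ 0 ≤ z 1 ∧ z 1 ≤ z 0
        exact ⟨⟨h1.trans h10, h0⟩, h1.le, h10.le⟩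
      rw [h0, measure_empty]
    · intro z hz
      rw [hRi, hLi hz.2]
  -- bookkeeping
  have e : KZ.of Z - KZ.of L =
      (KZ.of Z - KZ.of r) + (KZ.of r - KZ.of R) + (KZ.of R - KZ.of L) := by
    abel
  rw [e]
  exact add_mem (add_mem e1 e2) e3

end Summit.KontsevichZagierPeriods.HyperbolicBloch.OffTetraSectorKernel

end
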